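import Summits.AtomisticToContinuum.BoseEinsteinCondensation.Theses.BECCutLineWeakDisorder
import Summits.AtomisticToContinuum.BoseEinsteinCondensation.Theses.BECClassicalWindow
import Summits.AtomisticToContinuum.BoseEinsteinCondensation.Theses.BECWallDressingTransfer
import Summits.AtomisticToContinuum.BoseEinsteinCondensation.Theses.BECRieszReverseHolder
import Summits.AtomisticToContinuum.BoseEinsteinCondensation.Theorems.BECCutLineWeakDisorderGroundStateRigidityHardCoreOfConnected
import Summits.AtomisticToContinuum.BoseEinsteinCondensation.Theorems.BECCutLineWeakDisorderGroundStateRigidityStubPosOfConnected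
import Summits.AtomisticToContinuum.BoseEinsteinCondensation.Theorems.BECCutLineWeakDisorderGroundStateRigidityLocBdd
import Summits.AtomisticToContinuum.BoseEinsteinCondensation.Theorems.BECCutLineWeakDisorderGroundStateRigidityTheseusOfLonelyInsertion
import Summits.AtomisticToContinuum.BoseEinsteinCondensation.Theorems.BECCutLineWeakDisorderGroundStateRigidityStubNeighbourPoincare
import Summits.AtomisticToContinuum.BoseEinsteinCondensation.Theorems.BECCutLineWeakDisorderGroundStateRigidityStubInsertionWindow
import Summits.AtomisticToContinuum.BoseEinsteinCondensation.Theorems.BECCutLineWeakDisorderGroundStateRigidityStubSectorExclusion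
import Summits.AtomisticToContinuum.BoseEinsteinCondensation.Theorems.BECCutLineWeakDisorderGroundStateRigidityStubParkingTwoB
import Summits.AtomisticToContinuum.BoseEinsteinCondensation.Theorems.BECCutLineWeakDisorderGroundStateRigidityStubCoincidenceFree
import Summits.AtomisticToContinuum.BoseEinsteinCondensation.Theorems.BECCutLineWeakDisorderGroundStateRigidityStubAbsoluteFloor
import Summits.AtomisticToContinuum.BoseEinsteinCondensation.Theorems.BECCutLineWeakDisorderGroundStateRigidityStubCellInsertion
import Summits.AtomisticToContinuum.BoseEinsteinCondensation.Theorems.BECCutLineWeakDisorderGroundStateRigidityStubWallCut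
import Summits.AtomisticToContinuum.BoseEinsteinCondensation.Theorems.GroundStateRigidity.Negative.LoadBearingHypotheses
import Literature.MathematicalPhysics.QuantumManyBody.BoseGasDirichletMonotonicity
import Literature.MathematicalPhysics.QuantumManyBody.BoseGasHardSet
import Mathlib.Topology.Connected.LocallyPathConnected
import Mathlib.Topology.Algebra.Module.LocallyConvex
import HarnessLib.Audit

/-!
# Crux `GroundStateRigidity` — line `Sketch`, skeleton v11 (lead c5, 2026-08-17): ENERGY ORDERING + ZOO REDUCTION
(item stmt-AtomisticToContinuum-9072, shared verbatim by 8 routes; supersedes v8–v10 of `Lines/Sketch.lean`)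

Crux (fixed, by name): `GroundStateRigidity` — for every repulsive finite-range `v` there is `ρ₀ > 0` such that
for `0 < ρ < ρ₀`, all large `N` and every `η > 0` some `δ > 0` makes any two `δ`-near-minimisers of the Dirichlet
energy in the box of side `(N/ρ)^{1/3}` `η`-close in `L²` up to a constant phase.

## State (what is landed) and the three remaining stubs

Leads -0, c1–c4 landed Stubs 0–20, 15a–15g of `Sketch` and the reductions p108220, p122811, p130213. Lead c5, wave 1
(2026-08-17, all ACCEPTED): A `stub_neighbourPoincare` p173115, B `stub_insertionWindow` p172772 (+ `stub_cellInsertion`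
p172813, `stub_insertionBose` p172981, `stub_insertion` p173186, `stub_insertionDisjoint` p173101), C `stub_sectorExclusion`
p173762 (+Aux p173454/p173452/p173626), D `stub_parkingTwoB` p173646 (+Aux p173383), and the zoo-reduction support stubs
`stub_coincidenceFree` p172888, `stub_wallCut` p173629 (+Aux p173387), `stub_absoluteFloor` p172878.

v11 MERGES the two reductions. The strategist line `zoo-reduction` (`Lines/zoo_reduction.lean`) types v8's Stub 22 (the
zoo) over the closed set `hardRad v` of hard radii: (Z1) no positive hard radius ⇒ Perron–Frobenius through integrable
spikes on the coincidence-free box (`stub_coincidenceFree`, LANDED, + Stub PF at `b = 0`); (Z2) an outermost wall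
`b = max hardRad v` ⇒ FILLING below `b` is free at low density (Stub FILL, whose three hypotheses ABS, INS, CUT are all
LANDED) and the filled potential `v⁺ = ⊤·1_{(−∞,b]} + v·1_{(b,∞)}` is a plain hard core whose tail has no hard radius,
hence is integrable on every shell `{b + m ≤ |w|}` (`shell_lintegral_ne_top`). Where `zoo-reduction` ran Perron–Frobenius
for `v⁺` on the WHOLE free region `F_b` — connected by `stub_cubeConnected` (BBK's open question) — v11 runs it on the
ROOMY part only, exactly as v9/v10 did for the essential hard-core class: components of `F_b` with a PERMANENT MEMBER carry
no ground-state mass (Stub C fed with Stub A and the gap from Stub B, all landed, all valid for `v⁺`: Stub C needs only the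
pointwise core, Stub B only the finite range), the roomy part is chain-connected (Stub D landed + Stub E `stub_theseus` +
`stub_polygonalChain`), and positivity on it is Stub PF (integrable tail!). So:

    GroundStateRigidity  ⇐  E `stub_theseus` (OPEN geometry)  ∧  FILL `stub_fillBelowWall` (provable, L)
                            ∧  PF `stub_posCoreIntegrableTail` (provable, XL) ,

for EVERY admissible `v` — no `CubeConnected`, no zoo case list, no essential-boundedness hypothesis.

Lattice of kernels at `N b³ ≤ c L³`: `CubeConnected ⟹ (LI) ⟹ Theseus` (`theseus_of_lonelyInsertion` LANDED p171125,
re-exported as `theseus_of_lonelyInsertionKernel`); a jammed sparse frame refutes only `CubeConnected`, a "funnel" refutes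
`(LI)`, only a memberless relay ("ship of Theseus") refutes E — no mechanism known (KERNEL-c4 §3, ALT-LINES §2).

## Disproof used (Cruxes/GroundStateRigidity/Disproof.lean; Theorems/GroundStateRigidity/Negative/*)

`groundStateRigidity_false_without_finiteRange` (v ≡ ⊤): honoured — Stub B inserts beyond the range `R = max R₀ b`, FILL's
INS needs `4R₀ ≤ s`. `groundStateRigidity_false_at_all_densities` / `Negative/TwoHardSpheres*` (`not_hasUniqueGroundState_two`):
honoured by the low-density gates `ρ < ρ₁(v)` (finite energy), `ρ < ρ_b` (FILL), `2000 ρ ℓ³ < 1` (gap), `ρ b³ < min(c₁,c₂)`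
(parking/Theseus); at `N = 2` they force `L ≫ b`, where `F_b(2, L)` is connected and parked. `not_rigidAt_of_groundStateEnergy_eq_top`:
finite energy is supplied before rigidity is invoked.

## Stubs (3; `sorry` only inside `stub_*`)

* E `stub_theseus` (OPEN geometry, the kernel; shared verbatim with `permanent_member`/`lonely_insertion`).
* FILL `stub_fillBelowWall` (L, provable; verbatim from `zoo_reduction`, hypotheses ABS/INS/CUT landed).
* PF `stub_posCoreIntegrableTail` (XL, provable; verbatim from `zoo_reduction`; Stub 19 with integrable tails).

Composition (sorry-free): `hasUniqueGroundState_core_of_sectorOrdering` (pointwise core + shell-integrable tail),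
`uniqueOuterWall` (Z2), `uniqueNoWall` (Z1), `eventualUniqueness`, `GroundStateRigidity_proof` (+ 3 route copies).

[cite: BaryshnikovBubenikKahle2014, §6; ReedSimonIV1978, §XIII.12; LSSY2005, §2.1]
-/

noncomputable section

open MeasureTheory Filter Metric
open scoped ENNReal NNReal Topology

namespace Summit.AtomisticToContinuum.BoseEinsteinCondensation.Cruxes.GroundStateRigidity.Sketch

open Literature.MathematicalPhysics.QuantumManyBody.BoseGas
open Summit.AtomisticToContinuum.BoseEinsteinCondensation.Theorems.GroundStateRigidity
open Summit.AtomisticToContinuum.BoseEinsteinCondensation.Theorems.GroundStateRigidity.HardCoreOfConnected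

/-! ## Stubs -/

/-- **Stub E — OPEN KERNEL ("Theseus"; pure discrete geometry, strictly weaker than `CubeConnected`).**
There is an absolute `c₂ > 0` such that for `N b³ ≤ c₂ L³`: if, in the component of `X` in the free region
`F_b(N, L)`, EVERY label can be made `2b`-lonely somewhere (for each `i` some configuration of the component has all
other particles farther than `2b` from particle `i`), then the component contains a configuration in which ALL labels
are `2b`-lonely at once (all pair distances `> 2b`). Contrapositively: a non-principal ("trapped") component has a
PERMANENT MEMBER. True for every trap certified by Connelly's struts principle (a container-jammed backbone keeps each
member within `2b` of its contacts throughout its tight component; KERNEL-c4 §1–2), vacuous if `F_b` is connected;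
false only for a "ship-of-Theseus" trap that sheds every label while never dissolving — no mechanism known.
`CubeConnected` (v8 Stub 21) implies it, and so does lonely insertion `(LI)` (`theseus_of_lonelyInsertionKernel` below,
landed p171125); the converses fail (vault foams resp. funnels). Shared verbatim with `permanent_member` / `lonely_insertion`.
[cite: BaryshnikovBubenikKahle2014, §6; Kahle2012; TorquatoStillinger2001; ConnellyWhiteley1996] -/
theorem stub_theseus :
    ∃ c₂ : ℝ, 0 < c₂ ∧ ∀ (N : ℕ) (L b : ℝ), 0 < b → (N : ℝ) * b ^ 3 ≤ c₂ * L ^ 3 →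
      ∀ X ∈ {Z : Config N | Z ∈ boxN N L ∧ ∀ i j : Fin N, i ≠ j → b < dist (Z i) (Z j)},
        (∀ i : Fin N, ∃ Y ∈ connectedComponentIn
            {Z : Config N | Z ∈ boxN N L ∧ ∀ i j : Fin N, i ≠ j → b < dist (Z i) (Z j)} X,
          ∀ j : Fin N, j ≠ i → 2 * b < dist (Y i) (Y j)) →
        ∃ Y ∈ connectedComponentIn
            {Z : Config N | Z ∈ boxN N L ∧ ∀ i j : Fin N, i ≠ j → b < dist (Z i) (Z j)} X,
          ∀ i j : Fin N, i ≠ j → 2 * b < dist (Y i) (Y j) := by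
  sorry


/-- **Stub FILL — filling below a wall is free at low density (bonded exclusion + transfer).** GIVEN ABS,
INS and CUT (as hypotheses): for admissible `v` and a hard radius `b > 0` of `v` there is `ρ_b > 0` such that
for `0 < ρ < ρ_b` and all large `N`, in the box of side `L = (N/ρ)^{1/3}`, the filled potential
`v⁺ = (s ↦ if s ≤ b then ⊤ else v s)` has the same ground-state energy as `v`, and uniqueness of the
closed-form ground state for `v⁺` implies it for `v`. Proof (fixed `N ≥ 2`, `E₀(v) < ⊤` by
`stub_finiteEnergyLowDensity`). (1) BOND PENALTY: a `C¹` Dirichlet `f` of finite `v`-energy with `f = 0`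
where all pairs are `≥ b` satisfies `𝓔_v[f] ≥ (E₀(v, N−2, L) + c/b²)‖f‖²` with an absolute `c > 0`: `f`
vanishes on the wall `{some pair = b}` (finite raw energy), smooth cell cutoffs
`η_P = ∏_{p ∈ P} g⁻(d_p) ∏_{q ∉ P} g⁺(d_q)` (`g⁻ = 1` on `[0, b−δ]`, `0` on `[b,∞)`; `g⁺ = 0` on `[0,b]`, `1` on
`[b+δ,∞)`; at each point at most ONE `η_P ≠ 0`) give `C¹` pieces `η_P f` with
`∑_P 𝓔[η_P f] ≤ (1+θ)𝓔[f] + o_δ(1)` and `∑_P ‖η_P f‖² ≥ ‖f‖² − o_δ(1)` (wall-layer Poincaré as in CUT); for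
the distinguished pair `(i,j) = min P` the `C¹` fibre `r = xᵢ − xⱼ ↦ η_P f` is supported in the open ball
`|r| < b`, so `2∫|∇_r|² ≥ 2λ(b)∫|·|²` (1-D Dirichlet Poincaré in one Cartesian coordinate of `r`,
`λ(b) ≥ π²/(4b²)`), and the `C¹` fibre `X' ↦ η_P f` over the other `N − 2` particles is Dirichlet, so ABS
gives `E₀(v, N−2, L)` per unit mass (drop `½|∇_R|²`, `v(d_{ij})` and the cross interactions, all `≥ 0`;
Tonelli along a measure-preserving relabelling `Fin N ≃ Fin 2 ⊕ Fin (N−2)`). (2) EXCLUSION: if a ground state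
`Ψ` had mass `μ_B > 0` on `B = {some pair < b}`, approximants `Φ_k → Ψ` with `energy → E₀(v,N)` split by CUT
into `f_U^k + f_B^k` with `‖f_B^k‖² → μ_B`, `‖f_U^k‖² → 1 − μ_B`; ABS on `f_U^k` and (1) on `f_B^k` give
`E₀(N) ≥ (1 − μ_B)E₀(N) + μ_B (E₀(N−2) + c/b²)`, i.e. `E₀(N) ≥ E₀(N−2) + c/b²`, contradicting INS twice
(`E₀(N) ≤ E₀(N−2) + 2C_I/s²`) once `s = (128ρ)^{-1/3} ≥ 4R₀` and `2C_I/s² < c/b²` (low density). So every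
ground state of `v` vanishes a.e. on `B`. (3) TRANSFER: `E₀(v) ≤ E₀(v⁺)` and `q̄_v ≤ q̄_{v⁺}` by monotonicity;
conversely CUT applied to approximants of a ground state `Ψ` of `v` (vanishing on `B`) gives `C¹` states
`f_U^k/‖f_U^k‖ → Ψ` supported in `{all pairs > b}`, where `v⁺ = v`, so `E₀(v⁺) ≤ q̄_{v⁺}[Ψ] ≤ E₀(v)`; hence
every ground state of `v` is a ground state of `v⁺`, and uniqueness transfers (existence of a nonnegative
ground state of `v`: `stub_existsNonnegGroundState`). [cite: LSSY2005, Thm 2.2 and proof of Thm 2.4;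
LiebLoss2001, Thm 7.8; ReedSimonIV1978, §XIII.12 Thm XIII.47] -/
theorem stub_fillBelowWall :
    (∀ (N : ℕ) (v : ℝ → ℝ≥0∞) (L : ℝ) (f : Config N → ℂ), Measurable v → ContDiff ℝ 1 f →
      (∀ X, X ∉ boxN N L → f X = 0) →
      groundStateEnergy v N L * ∫⁻ X, (‖f X‖₊ : ℝ≥0∞) ^ 2 ≤
        ∫⁻ X, (kineticDensity f X + interaction v X * (‖f X‖₊ : ℝ≥0∞) ^ 2)) →
    (∃ C_I : ℝ, 0 < C_I ∧ ∀ (N : ℕ) (v : ℝ → ℝ≥0∞) (L R₀ s : ℝ), Measurable v → 0 ≤ R₀ →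
      (∀ r : ℝ, R₀ < r → v r = 0) → 0 < s → 4 * R₀ ≤ s →
      128 * ((N : ℝ) + 1) * s ^ 3 ≤ L ^ 3 →
      groundStateEnergy v (N + 1) L ≤ groundStateEnergy v N L + ENNReal.ofReal (C_I / s ^ 2)) →
    (∀ (N : ℕ) (v : ℝ → ℝ≥0∞) (L b ε : ℝ), Measurable v → 0 < b → b ∈ hardRad v → 0 < ε →
      ∀ Φ : TrialState N L, energy v Φ ≠ ⊤ →
      ∃ fU fB : Config N → ℂ, ContDiff ℝ 1 fU ∧ ContDiff ℝ 1 fB ∧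
        (∀ X, X ∉ boxN N L → fU X = 0) ∧ (∀ X, X ∉ boxN N L → fB X = 0) ∧
        (∀ (σ : Equiv.Perm (Fin N)) (X : Config N), fU (X ∘ σ) = fU X) ∧
        (∀ (σ : Equiv.Perm (Fin N)) (X : Config N), fB (X ∘ σ) = fB X) ∧
        (∀ X : Config N, (∃ i j : Fin N, i ≠ j ∧ dist (X i) (X j) ≤ b) → fU X = 0) ∧
        (∀ X : Config N, (∀ i j : Fin N, i ≠ j → b ≤ dist (X i) (X j)) → fB X = 0) ∧
        ∫⁻ X, (‖Φ.ψ X - (fU X + fB X)‖₊ : ℝ≥0∞) ^ 2 ≤ ENNReal.ofReal ε ∧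
        rawEnergy v fU + rawEnergy v fB ≤ energy v Φ + ENNReal.ofReal ε) →
    ∀ v : ℝ → ℝ≥0∞, IsRepulsiveFiniteRange v → ∀ b : ℝ, 0 < b → b ∈ hardRad v →
      ∃ ρb : ℝ, 0 < ρb ∧ ∀ ρ : ℝ, 0 < ρ → ρ < ρb → ∀ᶠ N : ℕ in atTop,
        groundStateEnergy (fun s => if s ≤ b then ⊤ else v s) N (sideLength ρ N) =
            groundStateEnergy v N (sideLength ρ N) ∧
          (HasUniqueGroundState (fun s => if s ≤ b then ⊤ else v s) N (sideLength ρ N) →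
            HasUniqueGroundState v N (sideLength ρ N)) := by
  sorry


/-- **Stub PF — a.e. positivity of nonnegative ground states on a chain-connected carrier, for a pointwise
hard core `(0, b]` (`b ≥ 0`; none if `b = 0`) whose tail is integrable on every shell `{b + m ≤ |w|}`,
`m > 0`** (Stub 19 of `Sketch` with the bounded tail replaced by an integrable one; the energy-truncation and
tube hypotheses of Stub 19 are proved inside). With `T_n = e^{-H(v ⊓ n)}` (`‖T_n‖ = e^{-E₀(v ⊓ n)}`,
`norm_fkL2_one_eq_exp_neg_groundStateEnergy`) and the landed closed-form Jensen inequality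
`stub_closedJensen`, `‖T_nΨ₀ − e^{-E₀}Ψ₀‖² ≤ e^{-2E₀(v⊓n)} − e^{-2E₀(v)} → 0` needs (α) TRUNCATION
`supₙ E₀(v ⊓ n) = E₀(v)`: for `b > 0` compare with `v_n = ⊤·1_{(0,b]} + (v ⊓ n)·1_{(b,∞)}` (landed
`groundStateEnergy_trunc_iSup_hardCore` for each `n`, after modifying `v_n` at the null radius `0`) and prove
`supₙ E₀(v_n) = E₀(v)` by the landed cut argument of Stubs 15a–15f with the core cutoff moved out to radii
`b + 2s < b + 3s`, amplitude truncation (`stub_truncHigh`: `|g| ≤ B`) making the excess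
`∫ (V − n)₊ |χ g|² ≤ B² N² L^{3N−3} ∫_{b+2s ≤ |w| ≤ R} (v − n)₊ → 0` (dominated convergence on the shell), and
`stub_kineticCauchy`; for `b = 0` the same with the collision cutoffs of `stub_pairCutoff` (Stub 10's proof
plus the one dominated-convergence term). (β) TUBES with integrable tails: along a segment keeping all pairs
`≥ b + 2m`, paths in the coordinate `ε`-tube keep all pairs `≥ b + m`, and the EXPECTED action there is
bounded uniformly in the start point and in `n` by `∑_{pairs} ∫₀¹ sup_y E[t_m(|xᵢ−xⱼ|(B_s))] ds ≤
6 N² (2/c⋆) ‖t_m‖_{L¹(ds)} ∫₀¹ (4πs)^{-1/2} ds` (`t_m = v·1_{[b+m,∞)}`; integrate the one-dimensional Gaussian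
factor of the cone coordinate first, where `|xᵢ − xⱼ|` moves at rate `≥ c⋆`; `‖t_m‖_{L¹} < ∞` from the shell
hypothesis by polar coordinates, `Measure.toSphere`, as in `BoseGasHardSetRadial`), so Jensen on the tube
event (`measure_ratTube_pos`) gives the `n`-uniform lower bound of `stub_localTubeCore`, chained as in
`stub_chainedTube`; (γ) the contradiction of Stub 19 verbatim (`setIntegral_mul_fkReal_comm`, Lindelöf points,
`fkL2_perronFrobenius`). [cite: ReedSimonIV1978, §XIII.12 Thm XIII.44; ChungZhao1995, Thm 2.4;
Simon1982, Thm B.1.1; Kato1966, VI §1.3 Thm 1.16] -/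
theorem stub_posCoreIntegrableTail :
    ∀ (N : ℕ) (v : ℝ → ℝ≥0∞) (L b : ℝ), 1 ≤ N → 0 < L → 0 ≤ b → Measurable v →
      (∀ s : ℝ, 0 < s → s ≤ b → v s = ⊤) →
      (∀ m : ℝ, 0 < m → ∫⁻ w in {w : Space | b + m ≤ ‖w‖}, v ‖w‖ ≠ ⊤) →
      ∀ S : Set (Config N), MeasurableSet S →
      S ⊆ {Z : Config N | Z ∈ boxN N L ∧ ∀ i j : Fin N, i ≠ j → b < dist (Z i) (Z j)} →
      (∀ X ∈ S, ∀ Y ∈ S, ∃ (k : ℕ) (Z : ℕ → Config N) (m : ℝ), Z 0 = X ∧ Z k = Y ∧ 0 < m ∧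
        (∀ l : ℕ, l ≤ k → Z l ∈ boxN N L) ∧
        ∀ l : ℕ, l < k → ∀ θ : ℝ, θ ∈ Set.Icc (0 : ℝ) 1 → ∀ i j : Fin N, i ≠ j →
          b + 2 * m ≤ ‖(1 - θ) • (Z l i - Z l j) + θ • (Z (l + 1) i - Z (l + 1) j)‖) →
      (∀ Ψ : Config N → ℂ, IsGroundState v L Ψ → ∀ᵐ X : Config N, X ∉ S → Ψ X = 0) →
      ∀ Ψ₀ : Config N → ℝ, (∀ X, 0 ≤ Ψ₀ X) → IsGroundState v L (fun X => (Ψ₀ X : ℂ)) →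
        ∀ᵐ X : Config N, X ∈ S → 0 < Ψ₀ X := by
  sorry


/-! ## Stub statements as named propositions -/

/-- Statement of the lonely-insertion kernel `(LI)` of `Lines/lonely_insertion.lean` (implies Stub E). -/
abbrev LonelyInsertionKernel : Prop :=
    ∃ c : ℝ, 0 < c ∧ ∀ (n : ℕ) (L b : ℝ), 0 < b → ((n + 1 : ℕ) : ℝ) * b ^ 3 ≤ c * L ^ 3 →
      ∀ Z ∈ {W : Config (n + 1) | W ∈ boxN (n + 1) L ∧ ∀ i j : Fin (n + 1), i ≠ j → b < dist (W i) (W j)},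
      ∀ i : Fin (n + 1),
        (∀ j : Fin (n + 1), j ≠ i → 2 * b < dist (Z i) (Z j)) →
        (∃ Y' ∈ connectedComponentIn
            {W : Config n | W ∈ boxN n L ∧ ∀ i j : Fin n, i ≠ j → b < dist (W i) (W j)}
            (fun j => Z (i.succAbove j)),
          ∀ j k : Fin n, j ≠ k → 2 * b < dist (Y' j) (Y' k)) →
        ∃ Y ∈ connectedComponentIn
            {W : Config (n + 1) | W ∈ boxN (n + 1) L ∧ ∀ i j : Fin (n + 1), i ≠ j → b < dist (W i) (W j)} Z,
          ∀ j k : Fin (n + 1), j ≠ k → 2 * b < dist (Y j) (Y k)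

/-- Statement of Stub E (the kernel of this skeleton). -/
abbrev Theseus : Prop :=
    ∃ c₂ : ℝ, 0 < c₂ ∧ ∀ (N : ℕ) (L b : ℝ), 0 < b → (N : ℝ) * b ^ 3 ≤ c₂ * L ^ 3 →
      ∀ X ∈ {Z : Config N | Z ∈ boxN N L ∧ ∀ i j : Fin N, i ≠ j → b < dist (Z i) (Z j)},
        (∀ i : Fin N, ∃ Y ∈ connectedComponentIn
            {Z : Config N | Z ∈ boxN N L ∧ ∀ i j : Fin N, i ≠ j → b < dist (Z i) (Z j)} X,
          ∀ j : Fin N, j ≠ i → 2 * b < dist (Y i) (Y j)) →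
        ∃ Y ∈ connectedComponentIn
            {Z : Config N | Z ∈ boxN N L ∧ ∀ i j : Fin N, i ≠ j → b < dist (Z i) (Z j)} X,
          ∀ i j : Fin N, i ≠ j → 2 * b < dist (Y i) (Y j)

/-! ## Kernel lattice: `(LI) ⟹ Theseus` (landed, p171125) -/

/-- The free region of exclusion distance `b` in the box (local abbreviation; the stubs state it inline). -/
abbrev free (N : ℕ) (L b : ℝ) : Set (Config N) :=
  {Z : Config N | Z ∈ boxN N L ∧ ∀ i j : Fin N, i ≠ j → b < dist (Z i) (Z j)}

/-- **Theseus from lonely insertion** (re-export of the landed theorem of `Lines/lonely_insertion.lean`, p171125): a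
proof of the `N`-local kernel `(LI)` closes Stub E. [cite: BaryshnikovBubenikKahle2014, §6] -/
theorem theseus_of_lonelyInsertionKernel (hLI : LonelyInsertionKernel) : Theseus :=
  LonelyInsertion.theseus_of_lonelyInsertion hLI

/-! ## Roomy and crowded sectors -/

/-- The union `U'` of the components of the free region that have a permanent member (a label with a neighbour
within `2b` at every configuration of the component). -/
abbrev crowded (N : ℕ) (L b : ℝ) : Set (Config N) :=
  {X : Config N | X ∈ free N L b ∧ ∃ i : Fin N, ∀ Y ∈ connectedComponentIn (free N L b) X,
    ∃ j : Fin N, j ≠ i ∧ dist (Y i) (Y j) ≤ 2 * b}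

/-- The union `S` of the components of the free region in which every label is somewhere `2b`-lonely (the carrier
of the ground states). -/
abbrev roomy (N : ℕ) (L b : ℝ) : Set (Config N) :=
  {X : Config N | X ∈ free N L b ∧ ∀ i : Fin N, ∃ Y ∈ connectedComponentIn (free N L b) X,
    ∀ j : Fin N, j ≠ i → 2 * b < dist (Y i) (Y j)}

/-- In an open subset of configuration space, a point of the connected component of `X` is joined to `X` by a path
inside the set (components of open sets of a locally path-connected space are path-connected). [folklore] -/
theorem joinedIn_of_mem_connectedComponentIn {N : ℕ} {F : Set (Config N)} (hF : IsOpen F) {X Z : Config N}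
    (hX : X ∈ F) (hZ : Z ∈ connectedComponentIn F X) : JoinedIn F X Z := by
  have hC : IsOpen (connectedComponentIn F X) := hF.connectedComponentIn
  have hconn : IsConnected (connectedComponentIn F X) := isConnected_connectedComponentIn_iff.2 hX
  have hpc : IsPathConnected (connectedComponentIn F X) := (hC.isConnected_iff_isPathConnected).1 hconn
  exact (hpc.joinedIn X (mem_connectedComponentIn hX) Z hZ).mono (connectedComponentIn_subset F X)

/-- A point outside `roomy` is outside the free region or in `crowded` (pure logic). [folklore] -/
theorem mem_crowded_of_not_mem_roomy {N : ℕ} {L b : ℝ} {X : Config N} (hX : X ∉ roomy N L b)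
    (hXf : X ∈ free N L b) : X ∈ crowded N L b := by
  refine ⟨hXf, ?_⟩
  by_contra h
  apply hX
  refine ⟨hXf, fun i => ?_⟩
  by_contra h'
  apply h
  refine ⟨i, fun Y hY => ?_⟩
  by_contra h''
  apply h'
  refine ⟨Y, hY, fun j hj => ?_⟩
  by_contra h3
  exact h'' ⟨j, hj, not_lt.1 h3⟩

/-- `roomy` is a union of components of the free region: the component of any of its points lies in it. [folklore] -/
theorem connectedComponentIn_subset_roomy {N : ℕ} {L b : ℝ} {X : Config N} (hX : X ∈ roomy N L b) :
    connectedComponentIn (free N L b) X ⊆ roomy N L b := by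
  intro Y hY
  refine ⟨connectedComponentIn_subset _ _ hY, fun i => ?_⟩
  obtain ⟨Z, hZ, hZi⟩ := hX.2 i
  refine ⟨Z, ?_, hZi⟩
  rwa [← connectedComponentIn_eq hY]

/-- `roomy` is open (components of the open free region are open). [folklore] -/
theorem isOpen_roomy (N : ℕ) (L b : ℝ) : IsOpen (roomy N L b) := by
  rw [isOpen_iff_mem_nhds]
  intro X hX
  have hF : IsOpen (free N L b) := HardCoreOfConnected.isOpen_free N L b
  have hC : IsOpen (connectedComponentIn (free N L b) X) := hF.connectedComponentIn
  exact Filter.mem_of_superset (hC.mem_nhds (mem_connectedComponentIn hX.1))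
    (connectedComponentIn_subset_roomy hX)


/-- **Uniqueness from sector ordering for a pointwise hard core with SHELL-INTEGRABLE tail** (the local statement
at `(v, N+1, L)`; v11 form of v9's `hasUniqueGroundState_hardCore_of_sectorOrdering` with the bounded tail replaced by an
integrable one: the positivity step is a HYPOTHESIS, supplied by Stub PF at the call site). For `v = ⊤` on `[0, b]`
pointwise and `L > 0`: IF ground states vanish a.e. on `crowded` (Stub C's
conclusion), parked configurations are joined (Stub D) and Theseus holds at `(N+1, L, b)`, and positivity on
chain-connected carriers holds (Stub PF as a hypothesis), then `E₀(N+1, L) < ⊤` implies `HasUniqueGroundState v (N+1) L`: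
ground states vanish off the open `S_{N+1}`-invariant carrier `roomy` (`stub_vanishOffFree` + exclusion), `roomy` is
chain-connected (Theseus + parking + `stub_polygonalChain`), nonnegative ground states are a.e. positive on it (PF), and
uniqueness follows (`stub_uniqueOfPosOn`). [cite: ReedSimonIV1978, §XIII.12 Thms XIII.44–47] -/
theorem hasUniqueGroundState_core_of_sectorOrdering (N : ℕ) (v : ℝ → ℝ≥0∞) (L b : ℝ)
    (hL : 0 < L) (hb : 0 < b) (hcore : ∀ s : ℝ, s ∈ Set.Icc 0 b → v s = ⊤)
    (hPF : ∀ S : Set (Config (N + 1)), MeasurableSet S →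
      S ⊆ free (N + 1) L b →
      (∀ X ∈ S, ∀ Y ∈ S, ∃ (k : ℕ) (Z : ℕ → Config (N + 1)) (m : ℝ), Z 0 = X ∧ Z k = Y ∧ 0 < m ∧
        (∀ l : ℕ, l ≤ k → Z l ∈ boxN (N + 1) L) ∧
        ∀ l : ℕ, l < k → ∀ θ : ℝ, θ ∈ Set.Icc (0 : ℝ) 1 → ∀ i j : Fin (N + 1), i ≠ j →
          b + 2 * m ≤ ‖(1 - θ) • (Z l i - Z l j) + θ • (Z (l + 1) i - Z (l + 1) j)‖) →
      (∀ Ψ : Config (N + 1) → ℂ, IsGroundState v L Ψ → ∀ᵐ X : Config (N + 1), X ∉ S → Ψ X = 0) →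
      ∀ Ψ₀ : Config (N + 1) → ℝ, (∀ X, 0 ≤ Ψ₀ X) → IsGroundState v L (fun X => (Ψ₀ X : ℂ)) →
        ∀ᵐ X : Config (N + 1), X ∈ S → 0 < Ψ₀ X)
    (hexcl : ∀ Ψ : Config (N + 1) → ℂ, IsGroundState v L Ψ →
      ∀ᵐ X : Config (N + 1), X ∈ crowded (N + 1) L b → Ψ X = 0)
    (hpark : ∀ X ∈ free (N + 1) L b, ∀ Y ∈ free (N + 1) L b,
      (∀ i j : Fin (N + 1), i ≠ j → 2 * b < dist (X i) (X j)) →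
      (∀ i j : Fin (N + 1), i ≠ j → 2 * b < dist (Y i) (Y j)) → JoinedIn (free (N + 1) L b) X Y)
    (hthes : ∀ X ∈ free (N + 1) L b,
      (∀ i : Fin (N + 1), ∃ Y ∈ connectedComponentIn (free (N + 1) L b) X,
        ∀ j : Fin (N + 1), j ≠ i → 2 * b < dist (Y i) (Y j)) →
      ∃ Y ∈ connectedComponentIn (free (N + 1) L b) X, ∀ i j : Fin (N + 1), i ≠ j → 2 * b < dist (Y i) (Y j))
    (hE : groundStateEnergy v (N + 1) L ≠ ⊤) : HasUniqueGroundState v (N + 1) L := by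
  have hF : IsOpen (free (N + 1) L b) := HardCoreOfConnected.isOpen_free (N + 1) L b
  set S : Set (Config (N + 1)) := roomy (N + 1) L b with hSdef
  have hSm : MeasurableSet S := (isOpen_roomy (N + 1) L b).measurableSet
  have hSsub : S ⊆ free (N + 1) L b := fun X hX => hX.1
  -- any two points of the carrier are joined inside the free region
  have hjoin : ∀ X ∈ S, ∀ Y ∈ S, JoinedIn (free (N + 1) L b) X Y := by
    intro X hX Y hY
    obtain ⟨ZX, hZX, hZXl⟩ := hthes X hX.1 hX.2
    obtain ⟨ZY, hZY, hZYl⟩ := hthes Y hY.1 hY.2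
    have h1 : JoinedIn (free (N + 1) L b) X ZX := joinedIn_of_mem_connectedComponentIn hF hX.1 hZX
    have h2 : JoinedIn (free (N + 1) L b) Y ZY := joinedIn_of_mem_connectedComponentIn hF hY.1 hZY
    have h3 : JoinedIn (free (N + 1) L b) ZX ZY :=
      hpark ZX (connectedComponentIn_subset _ _ hZX) ZY (connectedComponentIn_subset _ _ hZY) hZXl hZYl
    exact (h1.trans h3).trans h2.symm
  have hchain : ∀ X ∈ S, ∀ Y ∈ S, ∃ (k : ℕ) (Z : ℕ → Config (N + 1)) (m : ℝ), Z 0 = X ∧ Z k = Y ∧ 0 < m ∧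
      (∀ l : ℕ, l ≤ k → Z l ∈ boxN (N + 1) L) ∧
      ∀ l : ℕ, l < k → ∀ θ : ℝ, θ ∈ Set.Icc (0 : ℝ) 1 → ∀ i j : Fin (N + 1), i ≠ j →
        b + 2 * m ≤ ‖(1 - θ) • (Z l i - Z l j) + θ • (Z (l + 1) i - Z (l + 1) j)‖ :=
    fun X hX Y hY => stub_polygonalChain (N + 1) L b X Y (hjoin X hX Y hY)
  -- ground states vanish off the carrier
  have hvan : ∀ Ψ : Config (N + 1) → ℂ, IsGroundState v L Ψ → ∀ᵐ X : Config (N + 1), X ∉ S → Ψ X = 0 := by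
    intro Ψ hΨ
    filter_upwards [stub_vanishOffFree (N + 1) v L b hb hcore Ψ hΨ, hexcl Ψ hΨ] with X h1 h2 hX
    by_cases hXf : X ∈ free (N + 1) L b
    · exact h2 (mem_crowded_of_not_mem_roomy hX hXf)
    · exact h1 hXf
  refine stub_uniqueOfPosOn stub_lincombGroundState (N + 1) v L S hSm
    (stub_existsNonnegGroundState stub_compactness (N + 1) v L hE) hvan ?_
  intro Ψ₀ hΨ₀ hGS
  exact hPF S hSm hSsub hchain hvan Ψ₀ hΨ₀ hGS

/-- Elementary bookkeeping for the insertion scale: with `ℓ = R + b √(A/c) + 1` one has `ℓ > R`, `ℓ > 0` and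
`A/ℓ² < c/b²`. [folklore] -/
theorem insertionScale_bounds {A c b R : ℝ} (hA : 0 < A) (hc : 0 < c) (hb : 0 < b) (hR : 0 ≤ R) :
    R < R + b * Real.sqrt (A / c) + 1 ∧ 0 < R + b * Real.sqrt (A / c) + 1 ∧
      A / (R + b * Real.sqrt (A / c) + 1) ^ 2 < c / b ^ 2 := by
  have hs : 0 ≤ Real.sqrt (A / c) := Real.sqrt_nonneg _
  have hbs : 0 ≤ b * Real.sqrt (A / c) := mul_nonneg hb.le hs
  refine ⟨by linarith, by linarith, ?_⟩
  set ℓ : ℝ := R + b * Real.sqrt (A / c) + 1 with hℓ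
  have hℓpos : 0 < ℓ := by rw [hℓ]; linarith
  have hlt : b * Real.sqrt (A / c) < ℓ := by rw [hℓ]; linarith
  -- `b² (A/c) < ℓ²`
  have hsq : b ^ 2 * (A / c) < ℓ ^ 2 := by
    have h1 : (b * Real.sqrt (A / c)) ^ 2 < ℓ ^ 2 := by
      exact pow_lt_pow_left₀ hlt hbs (by norm_num)
    rw [mul_pow, Real.sq_sqrt (div_nonneg hA.le hc.le)] at h1
    exact h1
  rw [div_lt_div_iff₀ (by positivity) (by positivity)]
  have : A * b ^ 2 = (b ^ 2 * (A / c)) * c := by field_simp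
  rw [this]
  calc b ^ 2 * (A / c) * c < ℓ ^ 2 * c := by gcongr
    _ = c * ℓ ^ 2 := by ring


/-- **No hard radius beyond `b` ⇒ the tail is integrable on every shell `{b + m ≤ |w|}`** (`b ≥ 0`,
`m > 0`): the shell up to radius `R > R₀` is compact and disjoint from the hard set
(`mem_hardVec_iff_norm_mem_hardRad`, `setLIntegral_lt_top_of_isCompact_subset_compl_hardVec`), and `v(|w|) = 0`
beyond the range. [folklore] -/
theorem shell_lintegral_ne_top (v : ℝ → ℝ≥0∞) (hv : IsRepulsiveFiniteRange v) (b m : ℝ)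
    (hm : 0 < m) (hfree : ∀ r : ℝ, b < r → r ∉ hardRad v) :
    ∫⁻ w in {w : Space | b + m ≤ ‖w‖}, v ‖w‖ ≠ ⊤ := by
  obtain ⟨R₀, hR₀⟩ := hv.2
  set R : ℝ := max R₀ 0 + 1 with hRdef
  have hRR₀ : R₀ < R := by
    have := le_max_left R₀ 0
    linarith
  -- the integrand vanishes off the closed ball of radius `R`
  have hfun : (fun w : Space => v ‖w‖) =
      (closedBall (0 : Space) R).indicator (fun w : Space => v ‖w‖) := by
    funext w
    by_cases hw : w ∈ closedBall (0 : Space) R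
    · rw [Set.indicator_of_mem hw]
    · rw [Set.indicator_of_notMem hw]
      have hw' : R < ‖w‖ := by
        rw [mem_closedBall, dist_zero_right, not_le] at hw
        exact hw
      exact hR₀ _ (hRR₀.trans hw')
  have hK : IsCompact (closedBall (0 : Space) R ∩ {w : Space | b + m ≤ ‖w‖}) :=
    (isCompact_closedBall (0 : Space) R).inter_right (isClosed_le continuous_const continuous_norm)
  have hKH : closedBall (0 : Space) R ∩ {w : Space | b + m ≤ ‖w‖} ⊆ (hardVec v)ᶜ := by
    intro w hw hwH
    have hbr : b < ‖w‖ := by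
      have : b + m ≤ ‖w‖ := hw.2
      linarith
    exact hfree _ hbr (mem_hardVec_iff_norm_mem_hardRad.1 hwH)
  have heq : ∫⁻ w in {w : Space | b + m ≤ ‖w‖}, v ‖w‖ =
      ∫⁻ w in closedBall (0 : Space) R ∩ {w : Space | b + m ≤ ‖w‖}, v ‖w‖ := by
    calc ∫⁻ w in {w : Space | b + m ≤ ‖w‖}, v ‖w‖
        = ∫⁻ w in {w : Space | b + m ≤ ‖w‖},
            (closedBall (0 : Space) R).indicator (fun w : Space => v ‖w‖) w := by
          rw [← hfun]
      _ = ∫⁻ w in closedBall (0 : Space) R ∩ {w : Space | b + m ≤ ‖w‖}, v ‖w‖ := by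
          rw [lintegral_indicator measurableSet_closedBall,
            Measure.restrict_restrict measurableSet_closedBall]
  rw [heq]
  exact (setLIntegral_lt_top_of_isCompact_subset_compl_hardVec hK hKH).ne


/-- **(Z2) Eventual uniqueness at low density when `v` has a positive hard radius** — the heart of v11. With the
OUTERMOST wall `b = sSup (hardRad v) ∈ hardRad v` (`isClosed_hardRad`, `le_of_mem_hardRad`), FILL makes the filled potential
`v⁺ = ⊤` on `(−∞, b]`, `= v` beyond, interchangeable with `v` at `ρ < ρ_b` eventually; `v⁺` is a pointwise hard core of
radius `b` with finite range `R = max R₀ b` whose tail has no hard radius (`shell_lintegral_ne_top`). For `v⁺`: the gap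
`E₀(n+1) + g ≤ E₀(n) + c_P/b²` from Stub B at `2000 n ℓ³ ≤ L³`, `ℓ = R + b√(A/c_P) + 1` (landed), sector exclusion from
Stub C fed with Stub A (landed), parking (Stub D, landed) and Theseus (Stub E) at `(n+1) b³ ≤ min(c₁,c₂) L³`, positivity
from Stub PF; `hasUniqueGroundState_core_of_sectorOrdering` gives uniqueness for `v⁺`, and FILL transfers it to `v`.
`ρ₀ = min (ρ₁(v), ρ_b, min(c₁,c₂)/b³, 1/(2000 ℓ³))`. [cite: ReedSimonIV1978, §XIII.12 Thms XIII.44–48; LSSY2005, Thm 2.2] -/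
theorem uniqueOuterWall (v : ℝ → ℝ≥0∞) (hv : IsRepulsiveFiniteRange v)
    (hW : ∃ r : ℝ, 0 < r ∧ r ∈ hardRad v) (hStubE : Theseus) :
    ∃ ρ₀ : ℝ, 0 < ρ₀ ∧ ∀ ρ : ℝ, 0 < ρ → ρ < ρ₀ → ∀ᶠ N : ℕ in atTop,
      HasUniqueGroundState v N (sideLength ρ N) := by
  obtain ⟨R₀, hR₀⟩ := hv.2
  obtain ⟨r, hr0, hrH⟩ := hW
  obtain ⟨cP, hcP, hPoinc⟩ := stub_neighbourPoincare
  obtain ⟨A, hA, hins⟩ := stub_insertionWindow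
  obtain ⟨c₁, hc₁, hpark⟩ := stub_parkingTwoB
  obtain ⟨c₂, hc₂, hthes⟩ := hStubE
  obtain ⟨ρ₁, hρ₁, h₁⟩ := stub_finiteEnergyLowDensity v hv
  classical
  -- the outermost wall radius
  have hHne : (hardRad v).Nonempty := ⟨r, hrH⟩
  have hHbdd : BddAbove (hardRad v) := ⟨R₀, fun s hs => le_of_mem_hardRad hR₀ hs⟩
  obtain ⟨b, hbdef⟩ : ∃ b : ℝ, b = sSup (hardRad v) := ⟨_, rfl⟩
  have hbH : b ∈ hardRad v := by
    rw [hbdef]; exact isClosed_hardRad.csSup_mem hHne hHbdd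
  have hb : 0 < b := by
    rw [hbdef]; exact hr0.trans_le (le_csSup hHbdd hrH)
  have hmax : ∀ s : ℝ, b < s → s ∉ hardRad v := by
    intro s hs hsH
    rw [hbdef] at hs
    exact not_le.2 hs (le_csSup hHbdd hsH)
  have hbR₀ : b ≤ R₀ := le_of_mem_hardRad hR₀ hbH
  -- the filled potential `v⁺`
  set vp : ℝ → ℝ≥0∞ := fun s : ℝ => if s ≤ b then (⊤ : ℝ≥0∞) else v s with hvpdef
  have hvbm : Measurable vp := Measurable.ite measurableSet_Iic measurable_const hv.1
  have hcore : ∀ s : ℝ, s ∈ Set.Icc 0 b → vp s = ⊤ := by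
    intro s hs
    show (if s ≤ b then (⊤ : ℝ≥0∞) else v s) = ⊤
    rw [if_pos hs.2]
  have hcore' : ∀ s : ℝ, 0 < s → s ≤ b → vp s = ⊤ := by
    intro s _ hs
    show (if s ≤ b then (⊤ : ℝ≥0∞) else v s) = ⊤
    rw [if_pos hs]
  have htail_eq : ∀ s : ℝ, b < s → vp s = v s := by
    intro s hs
    show (if s ≤ b then (⊤ : ℝ≥0∞) else v s) = v s
    rw [if_neg (not_le.2 hs)]
  -- its tail is integrable on every shell beyond `b`
  have htail : ∀ m : ℝ, 0 < m → ∫⁻ w in {w : Space | b + m ≤ ‖w‖}, vp ‖w‖ ≠ ⊤ := by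
    intro m hm
    have hS : MeasurableSet {w : Space | b + m ≤ ‖w‖} :=
      (isClosed_le continuous_const continuous_norm).measurableSet
    have heq : ∫⁻ w in {w : Space | b + m ≤ ‖w‖}, vp ‖w‖ = ∫⁻ w in {w : Space | b + m ≤ ‖w‖}, v ‖w‖ := by
      refine setLIntegral_congr_fun hS ?_
      intro w hw
      have hbw : b < ‖w‖ := by
        have : b + m ≤ ‖w‖ := hw
        linarith
      exact htail_eq _ hbw
    rw [heq]
    exact shell_lintegral_ne_top v hv b m hm hmax
  -- the range of `v⁺`, enlarged so that it dominates `b`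
  set R : ℝ := max R₀ b with hRdef
  have hR0 : 0 ≤ R := hb.le.trans (le_max_right _ _)
  have hvpR : ∀ r : ℝ, R < r → vp r = 0 := by
    intro r hr
    have hbr : b < r := (le_max_right R₀ b).trans_lt hr
    rw [htail_eq r hbr]
    exact hR₀ r ((le_max_left _ _).trans_lt hr)
  -- FILL at the wall `b`
  obtain ⟨ρb, hρb, hfill⟩ := stub_fillBelowWall stub_absoluteFloor stub_cellInsertion stub_wallCut v hv b hb hbH
  -- the insertion scale and the density threshold
  set ℓ : ℝ := R + b * Real.sqrt (A / cP) + 1 with hℓdef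
  obtain ⟨hRℓ, hℓpos, hgapR⟩ := insertionScale_bounds hA hcP hb hR0
  have hc12 : 0 < min c₁ c₂ := lt_min hc₁ hc₂
  set ρ₀ : ℝ := min ρ₁ (min ρb (min (min c₁ c₂ / b ^ 3) (1 / (2000 * ℓ ^ 3)))) with hρ₀def
  have hρ₀ : 0 < ρ₀ := lt_min hρ₁ (lt_min hρb (lt_min (by positivity) (by positivity)))
  refine ⟨ρ₀, hρ₀, fun ρ hρ hρm => ?_⟩
  have hρ1 : ρ < ρ₁ := hρm.trans_le (min_le_left _ _)
  have hρb' : ρ < ρb := hρm.trans_le ((min_le_right _ _).trans (min_le_left _ _))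
  have hρc : ρ < min c₁ c₂ / b ^ 3 :=
    hρm.trans_le ((min_le_right _ _).trans ((min_le_right _ _).trans (min_le_left _ _)))
  have hρℓ : ρ < 1 / (2000 * ℓ ^ 3) :=
    hρm.trans_le ((min_le_right _ _).trans ((min_le_right _ _).trans (min_le_right _ _)))
  filter_upwards [h₁ ρ hρ hρ1, hfill ρ hρ hρb', eventually_ge_atTop 2] with N hE hF hN2
  obtain ⟨hE0eq, htransfer⟩ := hF
  obtain ⟨n, rfl⟩ : ∃ n, N = n + 1 := ⟨N - 1, by omega⟩
  have hn1 : 1 ≤ n := by omega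
  have hN1 : 1 ≤ n + 1 := by omega
  set L : ℝ := sideLength ρ (n + 1) with hLdef
  have hL : 0 < L := by
    rw [hLdef]; unfold sideLength
    exact Real.rpow_pos_of_pos (div_pos (by exact_mod_cast hN1) hρ) _
  have hL3 : L ^ 3 = ((n + 1 : ℕ) : ℝ) / ρ := by
    rw [hLdef, Negative.sideLength_pow_three hρ (by omega)]
  -- finite energy for the filled potential
  have hEb : groundStateEnergy vp (n + 1) L ≠ ⊤ := by
    show groundStateEnergy (fun s : ℝ => if s ≤ b then (⊤ : ℝ≥0∞) else v s) (n + 1) (sideLength ρ (n + 1)) ≠ ⊤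
    rw [hE0eq]; exact hE
  -- density: `(n+1) b³ ≤ c L³` for `c = c₁, c₂`
  have hdens : ∀ c : ℝ, min c₁ c₂ ≤ c → ((n + 1 : ℕ) : ℝ) * b ^ 3 ≤ c * L ^ 3 := by
    intro c hc
    rw [hL3]
    have hb3 : 0 < b ^ 3 := by positivity
    have h1 : ρ * b ^ 3 ≤ c := by
      have := (lt_div_iff₀ hb3).1 hρc
      exact this.le.trans hc
    have hNn : (0 : ℝ) ≤ ((n + 1 : ℕ) : ℝ) := by positivity
    calc ((n + 1 : ℕ) : ℝ) * b ^ 3 = (((n + 1 : ℕ) : ℝ) / ρ) * (ρ * b ^ 3) := by field_simp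
      _ ≤ (((n + 1 : ℕ) : ℝ) / ρ) * c := by gcongr
      _ = c * (((n + 1 : ℕ) : ℝ) / ρ) := by ring
  -- dilution for the insertion bound: `2000 n ℓ³ ≤ L³`
  have hdil : 2000 * (n : ℝ) * ℓ ^ 3 ≤ L ^ 3 := by
    rw [hL3]
    have hℓ3 : 0 < 2000 * ℓ ^ 3 := by positivity
    have h1 : ρ * (2000 * ℓ ^ 3) < 1 := by
      have := (lt_div_iff₀ hℓ3).1 hρℓ
      linarith
    have hn : (n : ℝ) ≤ ((n + 1 : ℕ) : ℝ) := by exact_mod_cast Nat.le_succ n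
    have hn0 : (0 : ℝ) ≤ n := by positivity
    rw [le_div_iff₀ hρ]
    calc 2000 * (n : ℝ) * ℓ ^ 3 * ρ = (n : ℝ) * (ρ * (2000 * ℓ ^ 3)) := by ring
      _ ≤ (n : ℝ) * 1 := by gcongr
      _ ≤ ((n + 1 : ℕ) : ℝ) := by rw [mul_one]; exact hn
  -- the gap for `v⁺`: insertion cost `A/ℓ²` strictly below the confinement cost `cP/b²`
  have hins' : groundStateEnergy vp (n + 1) L ≤ groundStateEnergy vp n L + ENNReal.ofReal (A / ℓ ^ 2) :=
    hins n L R ℓ vp hn1 hL hvbm hR0 hRℓ hvpR hdil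
  set g : ℝ≥0∞ := ENNReal.ofReal (cP / b ^ 2) - ENNReal.ofReal (A / ℓ ^ 2) with hgdef
  have hμlt : ENNReal.ofReal (A / ℓ ^ 2) < ENNReal.ofReal (cP / b ^ 2) :=
    (ENNReal.ofReal_lt_ofReal_iff (by positivity)).2 hgapR
  have hg : 0 < g := tsub_pos_of_lt hμlt
  have hgap : groundStateEnergy vp (n + 1) L + g ≤ groundStateEnergy vp n L + ENNReal.ofReal (cP / b ^ 2) := by
    calc groundStateEnergy vp (n + 1) L + g
        ≤ groundStateEnergy vp n L + ENNReal.ofReal (A / ℓ ^ 2) + g := add_le_add hins' le_rfl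
      _ = groundStateEnergy vp n L + (ENNReal.ofReal (A / ℓ ^ 2) + g) := add_assoc _ _ _
      _ = groundStateEnergy vp n L + ENNReal.ofReal (cP / b ^ 2) := by
          rw [hgdef, add_tsub_cancel_of_le hμlt.le]
  -- sector exclusion for `v⁺` (Stub C fed with Stub A at constant `cP`)
  have hexcl : ∀ Ψ : Config (n + 1) → ℂ, IsGroundState vp L Ψ →
      ∀ᵐ X : Config (n + 1), X ∈ crowded (n + 1) L b → Ψ X = 0 :=
    stub_sectorExclusion n vp L b cP g hL hb hcP hg hvbm hcore
      (fun i φ hφ hvan => hPoinc (n + 1) b i φ hb hφ hvan) hgap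
  -- uniqueness for `v⁺` on the roomy carrier, then transfer to `v`
  have hUb : HasUniqueGroundState vp (n + 1) L :=
    hasUniqueGroundState_core_of_sectorOrdering n vp L b hL hb hcore
      (fun S hSm hSsub hchain hvan Ψ₀ hΨ₀ hGS =>
        stub_posCoreIntegrableTail (n + 1) vp L b hN1 hL hb.le hvbm hcore' htail S hSm hSsub hchain hvan Ψ₀ hΨ₀ hGS)
      hexcl
      (fun X hX Y hY hXl hYl => hpark (n + 1) L b hb (hdens c₁ (min_le_left _ _)) X hX Y hY hXl hYl)
      (fun X hX hall => hthes (n + 1) L b hb (hdens c₂ (min_le_right _ _)) X hX hall) hEb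
  exact htransfer hUb

/-- **(Z1) Uniqueness at low density when `v` has no positive hard radius** (integrable spikes, in
particular every `v` essentially locally bounded on `(0, ∞)`): `E₀ < ⊤` eventually (Stub 5a), the carrier
is the coincidence-free box (CF: conull and chain-connected via Stub 17), positivity through spikes is PF at
`b = 0`, uniqueness is Stub 20 fed with Stubs 5b, 6. [cite: ReedSimonIV1978, §XIII.12 Thms XIII.44–47] -/
theorem uniqueNoWall (v : ℝ → ℝ≥0∞) (hv : IsRepulsiveFiniteRange v)
    (hZ : ∀ r : ℝ, 0 < r → r ∉ hardRad v) :
    ∃ ρ₀ : ℝ, 0 < ρ₀ ∧ ∀ ρ : ℝ, 0 < ρ → ρ < ρ₀ → ∀ᶠ N : ℕ in atTop,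
      HasUniqueGroundState v N (sideLength ρ N) := by
  obtain ⟨ρ₁, hρ₁, h₁⟩ := stub_finiteEnergyLowDensity v hv
  refine ⟨ρ₁, hρ₁, fun ρ hρ hρ₁' => ?_⟩
  filter_upwards [h₁ ρ hρ hρ₁', eventually_ge_atTop 1] with N hE hN
  have hL : 0 < sideLength ρ N := sideLength_pos_of_pos hρ hN
  obtain ⟨hnull, hjoin⟩ := stub_coincidenceFree N (sideLength ρ N) hL
  have hFm : MeasurableSet
      {Z : Config N | Z ∈ boxN N (sideLength ρ N) ∧ ∀ i j : Fin N, i ≠ j → 0 < dist (Z i) (Z j)} :=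
    (isOpen_free N (sideLength ρ N) 0).measurableSet
  -- ground states vanish off the coincidence-free box: off the box by the Dirichlet condition, and the
  -- coincidence set is null
  have hvan : ∀ Ψ : Config N → ℂ, IsGroundState v (sideLength ρ N) Ψ → ∀ᵐ X : Config N,
      X ∉ {Z : Config N | Z ∈ boxN N (sideLength ρ N) ∧ ∀ i j : Fin N, i ≠ j → 0 < dist (Z i) (Z j)} →
        Ψ X = 0 := by
    intro Ψ hΨ
    have hae : ∀ᵐ X : Config N, X ∉ {Z : Config N | ∃ i j : Fin N, i ≠ j ∧ Z i = Z j} :=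
      measure_eq_zero_iff_ae_notMem.1 hnull
    filter_upwards [hae] with X hX hXF
    by_cases hbox : X ∈ boxN N (sideLength ρ N)
    · exfalso
      refine hXF ⟨hbox, fun i j hij => ?_⟩
      rcases (dist_nonneg (x := X i) (y := X j)).lt_or_eq with h | h
      · exact h
      · exact absurd ⟨i, j, hij, dist_eq_zero.1 h.symm⟩ hX
    · exact hΨ.eq_zero X hbox
  refine stub_uniqueOfPosOn stub_lincombGroundState N v (sideLength ρ N) _ hFm
    (stub_existsNonnegGroundState stub_compactness N v (sideLength ρ N) hE) hvan ?_
  intro Ψ₀ hΨ₀ hGS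
  refine stub_posCoreIntegrableTail N v (sideLength ρ N) 0 hN hL le_rfl hv.1
    (fun s hs hs0 => absurd hs0 (not_le.2 hs))
    (fun m hm => shell_lintegral_ne_top v hv 0 m hm fun r hr => hZ r (by linarith))
    _ hFm subset_rfl ?_ hvan Ψ₀ hΨ₀ hGS
  intro X hX Y hY
  exact stub_polygonalChain N (sideLength ρ N) 0 X Y (hjoin X hX Y hY)


/-! ## Composition (sorry-free): the three stubs give the crux BY NAME -/

/-- **Eventual uniqueness for every admissible `v`** (Theseus as a hypothesis) by the wall dichotomy: no positive hard
radius (Z1, `uniqueNoWall`) or an outermost wall (Z2, `uniqueOuterWall`). [folklore] -/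
theorem eventualUniqueness (hStubE : Theseus) (v : ℝ → ℝ≥0∞) (hv : IsRepulsiveFiniteRange v) :
    ∃ ρ₀ : ℝ, 0 < ρ₀ ∧ ∀ ρ : ℝ, 0 < ρ → ρ < ρ₀ → ∀ᶠ N : ℕ in atTop,
      HasUniqueGroundState v N (sideLength ρ N) := by
  by_cases hW : ∃ r : ℝ, 0 < r ∧ r ∈ hardRad v
  · exact uniqueOuterWall v hv hW hStubE
  · exact uniqueNoWall v hv fun r hr hrH => hW ⟨r, hr, hrH⟩

/-- **The crux from the three registered stubs** (kernel-checked glue; the `sorry`s live inside `stub_theseus`,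
`stub_fillBelowWall`, `stub_posCoreIntegrableTail` only): eventual uniqueness (above) and rigidity-from-uniqueness
(landed Stub 1 fed with Stub 0). Concludes the crux decl (copy of route `BECClassicalWindow`, the decl named in the
skeleton record of this line) BY NAME; this is the theorem the skeleton checker reads. [cite: ReedSimonIV1978, §XIII.12] -/
theorem GroundStateRigidity_proof :
    Summit.AtomisticToContinuum.BoseEinsteinCondensation.Theses.BECClassicalWindow.GroundStateRigidity := by
  intro v hv
  obtain ⟨ρ₀, hρ₀, hU⟩ := eventualUniqueness stub_theseus v hv
  refine ⟨ρ₀, hρ₀, fun ρ hρ hρ₀' => ?_⟩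
  filter_upwards [hU ρ hρ hρ₀'] with N hN
  intro η hη
  exact stub_rigidityOfUnique stub_compactness v N (sideLength ρ N) hN η hη

/-- **`GroundStateRigidity` from Theseus alone, modulo the two provable analytic stubs** (the same glue with Stub E as
an explicit hypothesis — an `example`, so that the skeleton checker reads `GroundStateRigidity_proof`).
[cite: ReedSimonIV1978, §XIII.12] -/
example (hStubE : Theseus) :
    Summit.AtomisticToContinuum.BoseEinsteinCondensation.Theses.BECClassicalWindow.GroundStateRigidity := by
  intro v hv
  obtain ⟨ρ₀, hρ₀, hU⟩ := eventualUniqueness hStubE v hv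
  refine ⟨ρ₀, hρ₀, fun ρ hρ hρ₀' => ?_⟩
  filter_upwards [hU ρ hρ hρ₀'] with N hN
  intro η hη
  exact stub_rigidityOfUnique stub_compactness v N (sideLength ρ N) hN η hη

/-- The same composition read against the verbatim-shared decl of route `BECCutLineWeakDisorder`.
[cite: ReedSimonIV1978, §XIII.12] -/
theorem GroundStateRigidity_proof_cutLineWeakDisorder :
    Summit.AtomisticToContinuum.BoseEinsteinCondensation.Theses.BECCutLineWeakDisorder.GroundStateRigidity :=
  GroundStateRigidity_proof

/-- The same composition read against the verbatim-shared decl of route `BECWallDressingTransfer`.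
[cite: ReedSimonIV1978, §XIII.12] -/
theorem GroundStateRigidity_proof_wallDressingTransfer :
    Summit.AtomisticToContinuum.BoseEinsteinCondensation.Theses.BECWallDressingTransfer.GroundStateRigidity :=
  GroundStateRigidity_proof

/-- The same composition read against the verbatim-shared decl of route `BECRieszReverseHolder` (this lead's route).
[cite: ReedSimonIV1978, §XIII.12] -/
theorem GroundStateRigidity_proof_rieszReverseHolder :
    Summit.AtomisticToContinuum.BoseEinsteinCondensation.Theses.BECRieszReverseHolder.GroundStateRigidity :=
  GroundStateRigidity_proof

end Summit.AtomisticToContinuum.BoseEinsteinCondensation.Cruxes.GroundStateRigidity.Sketch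

end
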